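import Summits.HodgeConjecture.HodgeConjecture.Theorems.VHCAbelianSchemesRoadIsogenyPushforwardChernCharacter
import Literature.AlgebraicGeometry.Motives.AbelianVarietyIsogenyPullbackPushforwardHolds
import HarnessLib

/-!
# Road №4 (`VHCAbelianSchemesRoad`) — stub (c2) GRR `stub_isogenyPushforwardChernCharacter` CLOSED
# (skeleton v3.9 `Cruxes/DiagLocalOfMarkmanPinnedForall/Lines/birth.lean` f1912d6f699b48a2, crux stmt-HodgeConjecture-26512)

research route conditional on HC_CM; not a corollary; Q11.4-sentence-2 already refuted in dim ≥ 3.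

`isogenyPushforwardChernCharacter_holds : ∀ C : ChernCharacterBetti, IsogenyPushforwardChernCharacter C` — the statement of stub (c2),
sorry-free: the kernel reduction `isogenyPushforwardChernCharacter_of_isogenyPullbackPushforwardDecomposition` (p627181 ∕ p628408,
`…Theorems.VHCAbelianSchemesRoadIsogenyPushforwardChernCharacter`) applied to the now PROVED module-level fact
`Literature.AlgebraicGeometry.Motives.AbelianVariety.isogenyPullbackPushforwardDecomposition_holds` (p642704,
`Literature/AlgebraicGeometry/Motives/AbelianVarietyIsogenyPullbackPushforwardHolds.lean`: `g^*g_*F ≅ ∐_{x ∈ Ker g(ℂ)} τ_x^*F` for an isogeny of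
complex abelian varieties, by module Chase–Harrison–Rosenberg on the affine charts of `B = A/Ker g`). Nothing here says (c1), (c3), (c4), T,
26511 ∕ 26512 ∕ 23176, HC_AV or HC holds; HC_CM HELD, by name only.
-/

namespace Summit.HodgeConjecture.HodgeConjecture.Ring2.SemiregularRepresentatives

set_option linter.dupNamespace false -- the cell's namespace repeats the summit name, as in every `Ring2*` file

open Literature.AlgebraicGeometry Literature.AlgebraicGeometry.Motives Literature.AlgebraicGeometry.Motives.AbelianVariety
open Literature.AlgebraicGeometry.HodgeTheory

/-- **Stub (c2) GRR, CLOSED: `g^*ch_k(g_*E•) = #Ker g(ℂ)·ch_k(E•)` in every Chern character theory `C`** — for every isogeny `g` of a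
complex abelian variety and every bounded complex of vector bundles `E•` with `g_*E•` again one (`IsogenyPushforwardChernCharacter C`,
the registered statement of `stub_isogenyPushforwardChernCharacter`), from the kernel reduction to the module-level decomposition
`g^*g_*F ≅ ∐_{x ∈ Ker g(ℂ)} τ_x^*F` and that decomposition's proof `isogenyPullbackPushforwardDecomposition_holds`. -/
theorem isogenyPushforwardChernCharacter_holds : ∀ C : ChernCharacterBetti, IsogenyPushforwardChernCharacter C :=
  isogenyPushforwardChernCharacter_of_isogenyPullbackPushforwardDecomposition isogenyPullbackPushforwardDecomposition_holds

end Summit.HodgeConjecture.HodgeConjecture.Ring2.SemiregularRepresentatives
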